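import Summits.QuantumFields.QCD.Theorems.PauliWegnerSeaChiralOneScaleTrajectoryTransferAE
import Summits.QuantumFields.QCD.Theorems.PauliWegnerSeaChiralOneScaleTrajectoryBridges
import Summits.QuantumFields.QCD.Theorems.PauliWegnerSeaChiralOneScaleTrajectoryLowerPinRates
import Literature.MathematicalPhysics.QuantumFieldTheory.QCDGoldstoneBound
import Summits.QuantumFields.QCD.Theorems.PauliWegnerSeaChiralGluonicCompletionDefs

/-!
# Stub `stub_goldstone_of_secondMoment_two` of line `Sketch`
# (crux `PauliWegnerSea.ChiralGluonicCompletion`, stmt-QuantumFields-17498)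

**Goldstone assembly (`N_f = 2`).**  An eventual `|det|`-weighted SECOND-moment lower bound
`c e^{−(μ a_k n + p log(n+1))} ≤ E₊[Σ|G_f|²](k, S, n)` with `μ < ε`, valid on all tori `S ≥ L_k` and all
time separations `n ≤ S` eventually in `k`, at the DEGENERATE positive bare tuple
`t_k = m_crit(k) + a_k m / Z_m(k)`, gives `reg.HasGoldstoneBoundAt ε`; asked at every `ε > 0`,
`reg.HasGoldstoneBound`.

Mechanism.
* At `N_f = 2` and equal masses `det D = (det D_t)² = |det D|` as complex numbers
  (`ChiralOneScaleTrajectory.GoldstoneWitness.det_diracMatrix_two_degenerate_eq_norm`), so the real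
  `|det|`-weighted quotient `E₊[Σ|G_f|²]` IS the signed quotient, which is minus the honest connected
  correlator of the charged pion pair `A = ψ̄_g γ₅ ψ_f`, `B = ψ̄_f γ₅ ψ_g`, `g ≠ f`
  (`pseudoscalarDensityObs`, `…GoldstoneWitness.pionCorr_eq_neg_signedQuotient`, hypothesis-free);
  hence `‖corr‖ = |E₊[Σ|G_f|²]| ≥ E₊[Σ|G_f|²] ≥ c e^{−(μ a_k n + p log(n+1))}`.
* Tori and separations: with `μ' := (μ + ε)/2 ∈ (μ, ε)`, at each FIXED `k` exponentials beat powers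
  (`…GoldstoneWitness.eventually_lt_mul_exp_mul_rpow`), so some `n_k ≥ ⌈a_k⁻²⌉₊` has
  `c e^{−μ' a_k n_k} ≤ c e^{−(μ a_k n_k + p log(n_k+1))}`; then `a_k n_k ≥ a_k⁻¹ → ∞` (`a_k → 0⁺`) and
  `S_k := max (L_k) n_k`.
Sources: folklore bookkeeping (Montvay–Münster 1994 §5.1.2 (5.16) for the reality of the two-flavour
determinant, through the cited tree lemma).
-/

noncomputable section

namespace Summit.QuantumFields.QCD.Theorems.StronglyChiralSubsequence

open scoped BigOperators
open MeasureTheory Filter Topology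
open Literature.MathematicalPhysics.QuantumFieldTheory Literature.MathematicalPhysics.QuantumLattice
  Literature.Probability.LatticeModels
open Summit.QuantumFields.QCD.Cruxes.ChiralOneScaleTrajectory.GoldstoneWitness

/-- **Absorbing the log-loss at a fixed cutoff.**  For `a > 0`, `c > 0` and rates `μ < μ'`, eventually in
`n : ℕ`, `c e^{−μ' a n} ≤ c e^{−(μ a n + p log(n+1))}` (exponentials beat powers:
`e^{(μ'−μ) a n} (n+1)^{−p} → ∞`). [folklore] -/
theorem eventually_mul_exp_le_mul_exp_log {a c μ μ' : ℝ} (ha : 0 < a) (hc : 0 < c) (hμ : μ < μ')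
    (p : ℝ) :
    ∀ᶠ n : ℕ in atTop, c * Real.exp (-(μ' * (a * n))) ≤
      c * Real.exp (-(μ * (a * n) + p * Real.log (n + 1))) := by
  have hδ : 0 < (μ' - μ) * a := mul_pos (sub_pos.2 hμ) ha
  refine (eventually_lt_mul_exp_mul_rpow hδ hc p c).mono fun n hnC => ?_
  -- `c e^{-μ' a n} ≤ c e^{-(μ a n + p log(n+1))}` ⟸ `c < c e^{(μ'-μ) a n} (n+1)^{-p}`
  have hn0 : (0 : ℝ) < (n : ℝ) + 1 := by positivity
  have hexp : Real.exp (-(μ * (a * n) + p * Real.log (n + 1))) =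
      Real.exp (-(μ' * (a * n))) * (Real.exp ((μ' - μ) * a * n) * ((n : ℝ) + 1) ^ (-p)) := by
    rw [Real.rpow_def_of_pos hn0, ← Real.exp_add, ← Real.exp_add]
    congr 1
    ring
  have hpos : 0 < Real.exp (-(μ' * (a * n))) := Real.exp_pos _
  have key : c * Real.exp (-(μ' * (a * n))) <
      (c * Real.exp ((μ' - μ) * a * n) * ((n : ℝ) + 1) ^ (-p)) * Real.exp (-(μ' * (a * n))) :=
    mul_lt_mul_of_pos_right hnC hpos
  refine le_of_lt ?_
  calc c * Real.exp (-(μ' * (a * ↑n)))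
      < (c * Real.exp ((μ' - μ) * a * n) * ((n : ℝ) + 1) ^ (-p)) * Real.exp (-(μ' * (a * n))) := key
    _ = c * Real.exp (-(μ * (a * n) + p * Real.log (n + 1))) := by rw [hexp]; ring

/-- **Separations absorbing the log-loss with diverging physical time.**  For spacings `a_k > 0`,
`c > 0`, rates `μ < μ'`: there are separations `n : ℕ → ℕ` with `⌈a_k⁻²⌉₊ ≤ n_k` (so `a_k n_k ≥ a_k⁻¹`)
and `c e^{−μ' a_k n_k} ≤ c e^{−(μ a_k n_k + p log(n_k+1))}` for EVERY `k`. [folklore] -/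
theorem exists_seq_nat_log_le (a : ℕ → ℝ) (ha : ∀ k, 0 < a k) {c μ μ' : ℝ} (hc : 0 < c)
    (hμ : μ < μ') (p : ℝ) :
    ∃ n : ℕ → ℕ, ∀ k, ⌈((a k)⁻¹) ^ 2⌉₊ ≤ n k ∧
      c * Real.exp (-(μ' * (a k * n k))) ≤
        c * Real.exp (-(μ * (a k * n k) + p * Real.log (n k + 1))) := by
  have hex : ∀ k, ∃ N : ℕ, ⌈((a k)⁻¹) ^ 2⌉₊ ≤ N ∧
      c * Real.exp (-(μ' * (a k * N))) ≤
        c * Real.exp (-(μ * (a k * N) + p * Real.log (N + 1))) := fun k =>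
    ((eventually_ge_atTop _).and (eventually_mul_exp_le_mul_exp_log (ha k) hc hμ p)).exists
  choose n hn using hex
  exact ⟨n, hn⟩

/-- **Diverging physical times.**  If `a_k → 0` with `a_k > 0` and `⌈a_k⁻²⌉₊ ≤ n_k`, then
`a_k n_k → ∞` (`a_k n_k ≥ a_k · a_k⁻² = a_k⁻¹`). [folklore] -/
theorem tendsto_mul_seq_atTop_of_ceil_le {a : ℕ → ℝ} (ha : ∀ k, 0 < a k)
    (ha0 : Tendsto a atTop (𝓝 0)) {n : ℕ → ℕ} (hn : ∀ k, ⌈((a k)⁻¹) ^ 2⌉₊ ≤ n k) :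
    Tendsto (fun k => a k * n k) atTop atTop := by
  have ha' : Tendsto a atTop (𝓝[>] 0) :=
    tendsto_nhdsWithin_iff.2 ⟨ha0, Eventually.of_forall fun k => ha k⟩
  have hinv : Tendsto (fun k => (a k)⁻¹) atTop atTop := tendsto_inv_nhdsGT_zero.comp ha'
  refine tendsto_atTop_mono (fun k => ?_) hinv
  have hak := ha k
  calc (a k)⁻¹ = a k * ((a k)⁻¹) ^ 2 := by field_simp
    _ ≤ a k * (⌈((a k)⁻¹) ^ 2⌉₊ : ℝ) := by gcongr; exact Nat.le_ceil _
    _ ≤ a k * n k := by gcongr; exact_mod_cast hn k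

/-- **Stub E2₂ — Goldstone assembly (N_f = 2; provable).**  An eventual `|det|`-weighted second-moment lower bound
`c e^{−(μ a_k n + p log(n+1))} ≤ E₊[Σ|G_f|²]` with `μ < ε` at a degenerate positive tuple, on all tori `S ≥ L_k` and
separations `n ≤ S`, gives `reg.HasGoldstoneBoundAt ε`; asked at every `ε`, `reg.HasGoldstoneBound`.  At `N_f = 2` and
equal masses `det D = (det D_t)² = |det D|` (`ChiralOneScaleTrajectory.GoldstoneWitness.det_diracMatrix_two_degenerate_eq_norm`),
so `E₊[Σ|G_f|²]` is the SIGNED quotient, which is minus the honest connected correlator of the charged pion pair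
`A = ψ̄_g γ₅ ψ_f`, `B = ψ̄_f γ₅ ψ_g`, `g ≠ f` (`pseudoscalarDensityObs`, `…GoldstoneWitness.pionCorr_eq_neg_signedQuotient`,
hypothesis-free); choose `n_k → ∞` with `a_k n_k → ∞` and `p log(n_k+1) ≤ (μ' − μ) a_k n_k` eventually for some
`μ < μ' < ε` (here `n_k ≥ ⌈a_k⁻²⌉₊` large at fixed `k`), `S_k := max (L_k) n_k`; then `c e^{−μ' a_k n_k} ≤ ‖corr_k(S_k, n_k)‖`
eventually. [folklore] -/
theorem stub_goldstone_of_secondMoment_two : ∀ reg : QCDRegularisation 2, (∀ ε : ℝ, 0 < ε → ∃ m : ℝ, 0 < m ∧ ∃ (f : Fin 2) (μ c p : ℝ), μ < ε ∧ 0 < c ∧ ∀ᶠ k in atTop, ∀ S : ℕ, reg.L k ≤ S → ∀ n : ℕ, n ≤ S → c * Real.exp (-(μ * (reg.a k * n) + p * Real.log (n + 1))) ≤ (∫ U : GaugeConfig 4 (2 * S + 1) (Matrix.specialUnitaryGroup (Fin 3) ℂ), ‖(diracMatrix U fun _ : Fin 2 => reg.mcrit k + reg.a k * m / reg.Zm k).det‖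 * (∑ a : Fin 3, ∑ i : Fin 4, ∑ b : Fin 3, ∑ j : Fin 4, ‖(diracMatrix U fun _ : Fin 2 => reg.mcrit k + reg.a k * m / reg.Zm k)⁻¹ (quarkEquiv (f, (Torus.proj (2 * S + 1) 0, a, i))) (quarkEquiv (f, (Torus.proj (2 * S + 1) (Pi.single 0 (n : ℤ)), b, j)))‖ ^ (2 : ℕ)) ∂(wilsonMeasure (fundamentalRep (Fin 3)) (reg.β k))) / (∫ U : GaugeConfig 4 (2 * S + 1) (Matrix.specialUnitaryGroup (Fin 3) ℂ), ‖(diracMatrix U fun _ : Fin 2 => reg.mcrit k + reg.a k * m / reg.Zm k).det‖ ∂(wilsonMeasure (fundamentalRep (Fin 3)) (reg.β k)))) → reg.HasGoldstoneBound := by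
  intro reg h ε hε
  obtain ⟨m, hm, f, μ, c, p, hμ, hc, hev⟩ := h ε hε
  -- the other flavour
  have hsucc : ∀ f' : Fin 2, f' ≠ f' + 1 := by decide
  obtain ⟨g, hfg⟩ : ∃ g : Fin 2, f ≠ g := ⟨f + 1, hsucc f⟩
  -- an intermediate rate `μ < μ' < ε`
  set μ' : ℝ := (μ + ε) / 2 with hμ'
  have hμμ' : μ < μ' := by rw [hμ']; linarith
  have hμ'ε : μ' < ε := by rw [hμ']; linarith
  -- separations absorbing the log-loss, with diverging physical time, and the tori
  obtain ⟨n, hn⟩ := exists_seq_nat_log_le reg.a reg.a_pos hc hμμ' p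
  have hdiv : Tendsto (fun k => reg.a k * n k) atTop atTop :=
    tendsto_mul_seq_atTop_of_ceil_le reg.a_pos reg.tendsto_a fun k => (hn k).1
  refine ⟨fun _ => m, fun _ => hm, μ', c, hμ'ε, hc, 1, 1,
    pseudoscalarDensityObs 2 (Matrix.single g f (1 : ℂ)),
    pseudoscalarDensityObs 2 (Matrix.single f g (1 : ℂ)),
    fun k => max (reg.L k) (n k), n, fun k => le_max_left _ _, fun k => le_max_right _ _, hdiv, ?_⟩
  filter_upwards [hev] with k hk
  have hle := hk (max (reg.L k) (n k)) (le_max_left _ _) (n k) (le_max_right _ _)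
  have hmq : (fun fl => (reg.scheme (fun _ : Fin 2 => m) 0 0).mq fl k) =
      fun _ : Fin 2 => reg.mcrit k + reg.a k * m / reg.Zm k := by
    funext fl
    simp [QCDRegularisation.scheme_mq]
  rw [hmq, pionCorr_eq_neg_signedQuotient _ _ hfg rfl (n k), norm_neg]
  -- abbreviations at the fixed `k`
  set S : ℕ := max (reg.L k) (n k) with hS
  set mq : Fin 2 → ℝ := fun _ => reg.mcrit k + reg.a k * m / reg.Zm k with hmq_def
  set ν := wilsonMeasure (d := 4) (L := 2 * S + 1) (fundamentalRep (Fin 3)) (reg.β k) with hν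
  set X : GaugeConfig 4 (2 * S + 1) (Matrix.specialUnitaryGroup (Fin 3) ℂ) → ℝ := fun U =>
    ∑ a : Fin 3, ∑ i : Fin 4, ∑ b : Fin 3, ∑ j : Fin 4,
      ‖(diracMatrix U mq)⁻¹ (quarkEquiv (f, (Torus.proj (2 * S + 1) 0, a, i)))
        (quarkEquiv (f, (Torus.proj (2 * S + 1) (Pi.single 0 (n k : ℤ)), b, j)))‖ ^ (2 : ℕ) with hX
  -- at two degenerate flavours the signed determinant is its modulus
  have hdet : ∀ U : GaugeConfig 4 (2 * S + 1) (Matrix.specialUnitaryGroup (Fin 3) ℂ),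
      (diracMatrix U mq).det = ((‖(diracMatrix U mq).det‖ : ℝ) : ℂ) := fun U =>
    det_diracMatrix_two_degenerate_eq_norm U _
  have hnum : (∫ U, (diracMatrix U mq).det * ((X U : ℝ) : ℂ) ∂ν) =
      ((∫ U, ‖(diracMatrix U mq).det‖ * X U ∂ν : ℝ) : ℂ) := by
    rw [← integral_complex_ofReal]
    refine integral_congr_ae (Eventually.of_forall fun U => ?_)
    beta_reduce
    rw [Complex.ofReal_mul, ← hdet U]
  have hden : (∫ U, (diracMatrix U mq).det ∂ν) = ((∫ U, ‖(diracMatrix U mq).det‖ ∂ν : ℝ) : ℂ) := by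
    rw [← integral_complex_ofReal]
    exact integral_congr_ae (Eventually.of_forall fun U => hdet U)
  rw [hnum, hden, ← Complex.ofReal_div, Complex.norm_real, Real.norm_eq_abs]
  exact (hn k).2.trans (hle.trans (le_abs_self _))

end Summit.QuantumFields.QCD.Theorems.StronglyChiralSubsequence

end
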